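import Literature.Probability.LatticeModels.LatticeLaplacian
import HarnessLib

/-!
# The discrete Dirichlet problem on a finite subset of `ℤ²` with two-sided (edge) boundary data

Topic `Literature/Probability/LatticeModels`; companion of `LatticeLaplacian.lean` (nearest-neighbour
Laplacian `latticeLaplacian`, maximum principle, and the Dirichlet problem with *vertex* data on a
finite `S ⊆ ℤ²`). Here the datum is carried by the boundary **edges**: for a finite
`S ⊆ ℤ² = Site 2` and `g : Site 2 → Site 2 → ℝ`, the *edge-data Dirichlet extension*
`u = slitEdgeDirichletExtension S g` is the unique function with `u = 0` off `S` and

  `4 · u v = ∑_{k < 4} (if v + e_k ∈ S then u (v + e_k) else g v (v + e_k))`   (`v ∈ S`):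

an exterior neighbour `w = v + e_k ∉ S` contributes the datum `g v w` of the boundary edge `(v, w)`,
which may depend on the interior endpoint `v`. When `S` approximates a slit domain, a site on the
slit is seen from both banks and the two banks may carry different data — what the vertex problem
cannot express, and why route `CriticalPhenomena/SAWScalingLimit/SAWImaginaryGeometry` (crux
`FlowLineMeanValue`: winding data along an explored self-avoiding path) asked for the notion.
Probabilistically `u v = E_v[g (X_{τ-1}, X_τ)]` for simple random walk exiting `S` at time `τ`
(law of the exit *edge*; not formalised here).

## Contents (all proved)

* `IsSlitEdgeDirichletSolution S g u` and its Laplacian form `Δ u = -slitEdgeBoundarySum S g` on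
  `S`; **existence** for finite `S` (`exists_isSlitEdgeDirichletSolution`: the Dirichlet operator of
  `LatticeLaplacian.lean` is injective, hence surjective) and **uniqueness**
  (`IsSlitEdgeDirichletSolution.unique`: the difference of two solutions is harmonic on `S` and
  vanishes off `S`), packaged as `isSlitEdgeDirichletSolution_iff_eq`;
* `slitEdgeDirichletExtension S g`: `_eq_zero_of_not_mem`, `_mean_value`,
  `latticeLaplacian_slitEdgeDirichletExtension`, locality `_congr` (only boundary edges matter),
  linearity in `g` (`_add`, `_smul`, `_zero`, `_neg`, `_sub`, `_sum`);
* the **maximum principle** `min g ≤ u ≤ max g` on `S` over the boundary edges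
  (`slitEdgeDirichletExtension_le_of_forall_le`, `le_slitEdgeDirichletExtension_of_forall_le`,
  `abs_slitEdgeDirichletExtension_le`), positivity and monotonicity in `g`;
* compatibility with the vertex problem (`_eq_of_isLatticeHarmonicOn`: for `g v w = h w` the
  extension is the harmonic extension of `h`) and constants (`_const`).

References: the vertex-data statements are classical — G. F. Lawler, V. Limic, *Random Walk: A
Modern Introduction* (CUP 2010, bib key `LawlerLimic2010`), §6.1–6.2; the edge-data variant is the
same linear algebra (an exterior neighbour enters the mean-value identity only through the edge
joining it to `v`) and everything here is [folklore]. Mathlib has no discrete harmonic functions on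
`ℤ²` (cf. `LatticeLaplacian.lean`).
-/

noncomputable section

namespace Literature.Probability.LatticeModels

open Finset

variable {S : Set (Site 2)}

/-! ### Solutions of the edge-data Dirichlet problem -/

open scoped Classical in
/-- The **edge boundary source** of the data `g` at `v`: the sum of `g v (v + e_k)` over the
exterior neighbours `v + e_k ∉ S` of `v` (zero when all four neighbours lie in `S`). [folklore] -/
def slitEdgeBoundarySum (S : Set (Site 2)) (g : Site 2 → Site 2 → ℝ) (v : Site 2) : ℝ :=
  ∑ k : Fin 4, if v + cornerUnit k ∈ S then 0 else g v (v + cornerUnit k)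

open scoped Classical in
/-- `u` **solves the edge-data Dirichlet problem** on `S` with data `g`: `u = 0` off `S` and, at
every `v ∈ S`, the mean-value identity
`4 u(v) = ∑_{k<4} (if v + e_k ∈ S then u (v + e_k) else g v (v + e_k))` — an exterior neighbour
`w = v + e_k` contributes the datum `g v w` of the boundary edge `(v, w)` (two banks of a slit may
thus carry different data). [folklore] -/
def IsSlitEdgeDirichletSolution (S : Set (Site 2)) (g : Site 2 → Site 2 → ℝ) (u : Site 2 → ℝ) :
    Prop :=
  (∀ w ∉ S, u w = 0) ∧
    ∀ v ∈ S, 4 * u v =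
      ∑ k : Fin 4, (if v + cornerUnit k ∈ S then u (v + cornerUnit k) else g v (v + cornerUnit k))

open scoped Classical in
/-- **The edge-data (slit) Dirichlet extension** of `g` into `S`: the solution of the edge-data
Dirichlet problem `IsSlitEdgeDirichletSolution S g` when one exists (always, and uniquely, for
finite `S`: `isSlitEdgeDirichletSolution_iff_eq`), and `0` otherwise (junk value, documented:
for infinite `S` nothing is claimed beyond `slitEdgeDirichletExtension_eq_zero_of_not_mem`).
[folklore] -/
def slitEdgeDirichletExtension (S : Set (Site 2)) (g : Site 2 → Site 2 → ℝ) : Site 2 → ℝ :=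
  if h : ∃ u, IsSlitEdgeDirichletSolution S g u then Classical.choose h else 0

open scoped Classical in
/-- Splitting the mean-value sum of a function vanishing off `S` into the neighbour sum and the
edge boundary source. [folklore] -/
theorem sum_ite_eq_sum_add_slitEdgeBoundarySum {u : Site 2 → ℝ} (hu : ∀ w ∉ S, u w = 0)
    (g : Site 2 → Site 2 → ℝ) (v : Site 2) :
    (∑ k : Fin 4, (if v + cornerUnit k ∈ S then u (v + cornerUnit k) else g v (v + cornerUnit k)))
      = (∑ k : Fin 4, u (v + cornerUnit k)) + slitEdgeBoundarySum S g v := by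
  rw [slitEdgeBoundarySum, ← Finset.sum_add_distrib]
  refine Finset.sum_congr rfl fun k _ => ?_
  by_cases hk : v + cornerUnit k ∈ S
  · simp [hk]
  · simp [hk, hu _ hk]

/-- **Laplacian form.** `u` solves the edge-data problem iff `u = 0` off `S` and
`Δ u (v) = -slitEdgeBoundarySum S g v` at every `v ∈ S` (a Poisson equation for the extension by
zero). [folklore] -/
theorem isSlitEdgeDirichletSolution_iff_latticeLaplacian {g : Site 2 → Site 2 → ℝ}
    {u : Site 2 → ℝ} :
    IsSlitEdgeDirichletSolution S g u ↔
      (∀ w ∉ S, u w = 0) ∧ ∀ v ∈ S, latticeLaplacian u v = -slitEdgeBoundarySum S g v := by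
  refine and_congr_right fun hu => forall₂_congr fun v _ => ?_
  rw [latticeLaplacian_eq, sum_ite_eq_sum_add_slitEdgeBoundarySum hu]
  constructor <;> intro h <;> linarith

/-- **Existence.** On a finite set the edge-data Dirichlet problem has a solution: the Dirichlet
operator `u ↦ (Δ extendByZero u)|_S` is injective (`dirichletOperator_injective`, maximum
principle) hence surjective, so `Δ u = -slitEdgeBoundarySum S g` is solvable. [folklore] -/
theorem exists_isSlitEdgeDirichletSolution (hS : S.Finite) (g : Site 2 → Site 2 → ℝ) :
    ∃ u, IsSlitEdgeDirichletSolution S g u := by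
  have hsurj : Function.Surjective (dirichletOperator S) := by
    haveI : Fintype S := hS.fintype
    exact LinearMap.injective_iff_surjective.1 (dirichletOperator_injective hS)
  obtain ⟨u₀, hu₀⟩ := hsurj fun v => -slitEdgeBoundarySum S g v
  refine ⟨extendByZero S u₀, isSlitEdgeDirichletSolution_iff_latticeLaplacian.2
    ⟨fun w hw => extendByZero_of_not_mem u₀ hw, fun v hv => ?_⟩⟩
  have h1 := congrArg (fun f : S → ℝ => f ⟨v, hv⟩) hu₀
  simpa [dirichletOperator] using h1

/-- **Uniqueness.** On a finite set two solutions of the edge-data Dirichlet problem coincide: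
their difference vanishes off `S` and is harmonic on `S` (`IsLatticeHarmonicOn.eq_of_eq_boundary`).
[folklore] -/
theorem IsSlitEdgeDirichletSolution.unique (hS : S.Finite) {g : Site 2 → Site 2 → ℝ}
    {u₁ u₂ : Site 2 → ℝ} (h₁ : IsSlitEdgeDirichletSolution S g u₁)
    (h₂ : IsSlitEdgeDirichletSolution S g u₂) : u₁ = u₂ := by
  rw [isSlitEdgeDirichletSolution_iff_latticeLaplacian] at h₁ h₂
  have hharm : IsLatticeHarmonicOn (u₁ - u₂) S := fun v hv => by
    rw [latticeLaplacian_sub, h₁.2 v hv, h₂.2 v hv, sub_self]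
  have hzero : IsLatticeHarmonicOn (fun _ : Site 2 => (0 : ℝ)) S := fun v _ =>
    latticeLaplacian_const 0 v
  funext x
  by_cases hx : x ∈ S
  · have key := hharm.eq_of_eq_boundary hS hzero
      (fun w hw => by rw [Pi.sub_apply, h₁.1 w hw.1, h₂.1 w hw.1, sub_self]) x hx
    exact sub_eq_zero.1 key
  · rw [h₁.1 x hx, h₂.1 x hx]

/-- Solutions add. [folklore] -/
theorem IsSlitEdgeDirichletSolution.add {g₁ g₂ : Site 2 → Site 2 → ℝ} {u₁ u₂ : Site 2 → ℝ}
    (h₁ : IsSlitEdgeDirichletSolution S g₁ u₁) (h₂ : IsSlitEdgeDirichletSolution S g₂ u₂) :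
    IsSlitEdgeDirichletSolution S (g₁ + g₂) (u₁ + u₂) := by
  refine ⟨fun w hw => by simp [h₁.1 w hw, h₂.1 w hw], fun v hv => ?_⟩
  rw [Pi.add_apply, mul_add, h₁.2 v hv, h₂.2 v hv, ← Finset.sum_add_distrib]
  refine Finset.sum_congr rfl fun k _ => ?_
  split_ifs <;> simp

/-- Solutions scale. [folklore] -/
theorem IsSlitEdgeDirichletSolution.smul {g : Site 2 → Site 2 → ℝ} {u : Site 2 → ℝ}
    (h : IsSlitEdgeDirichletSolution S g u) (c : ℝ) :
    IsSlitEdgeDirichletSolution S (c • g) (c • u) := by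
  refine ⟨fun w hw => by simp [h.1 w hw], fun v hv => ?_⟩
  rw [Pi.smul_apply, smul_eq_mul, mul_left_comm, h.2 v hv, Finset.mul_sum]
  refine Finset.sum_congr rfl fun k _ => ?_
  split_ifs <;> simp

/-- Only the data on boundary edges `(v, v + e_k)`, `v ∈ S`, `v + e_k ∉ S`, enter the problem.
[folklore] -/
theorem isSlitEdgeDirichletSolution_congr {g₁ g₂ : Site 2 → Site 2 → ℝ}
    (h : ∀ v ∈ S, ∀ k : Fin 4, v + cornerUnit k ∉ S →
      g₁ v (v + cornerUnit k) = g₂ v (v + cornerUnit k)) (u : Site 2 → ℝ) :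
    IsSlitEdgeDirichletSolution S g₁ u ↔ IsSlitEdgeDirichletSolution S g₂ u := by
  classical
  refine and_congr_right fun _ => forall₂_congr fun v hv => ?_
  have hk : ∀ k : Fin 4,
      (if v + cornerUnit k ∈ S then u (v + cornerUnit k) else g₁ v (v + cornerUnit k)) =
        (if v + cornerUnit k ∈ S then u (v + cornerUnit k) else g₂ v (v + cornerUnit k)) := fun k => by
    by_cases hk : v + cornerUnit k ∈ S
    · simp [hk]
    · simp [hk, h v hv k hk]
  rw [Finset.sum_congr rfl fun k _ => hk k]

/-! ### The extension: defining properties -/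

/-- The extension vanishes off `S` (for every `S`). [folklore] -/
theorem slitEdgeDirichletExtension_eq_zero_of_not_mem (g : Site 2 → Site 2 → ℝ) {w : Site 2}
    (hw : w ∉ S) : slitEdgeDirichletExtension S g w = 0 := by
  unfold slitEdgeDirichletExtension
  split_ifs with h
  · exact (Classical.choose_spec h).1 w hw
  · rfl

/-- On a finite set the extension solves the edge-data Dirichlet problem. [folklore] -/
theorem isSlitEdgeDirichletSolution_slitEdgeDirichletExtension (hS : S.Finite)
    (g : Site 2 → Site 2 → ℝ) :
    IsSlitEdgeDirichletSolution S g (slitEdgeDirichletExtension S g) := by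
  rw [slitEdgeDirichletExtension, dif_pos (exists_isSlitEdgeDirichletSolution hS g)]
  exact Classical.choose_spec _

/-- **Existence and uniqueness**: on a finite set, `u` solves the edge-data Dirichlet problem iff
`u` is the extension. [folklore] -/
theorem isSlitEdgeDirichletSolution_iff_eq (hS : S.Finite) {g : Site 2 → Site 2 → ℝ}
    {u : Site 2 → ℝ} : IsSlitEdgeDirichletSolution S g u ↔ u = slitEdgeDirichletExtension S g :=
  ⟨fun h => h.unique hS (isSlitEdgeDirichletSolution_slitEdgeDirichletExtension hS g),
    fun h => h ▸ isSlitEdgeDirichletSolution_slitEdgeDirichletExtension hS g⟩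

open scoped Classical in
/-- **The mean-value property** of the extension at a site of the finite set `S`. [folklore] -/
theorem slitEdgeDirichletExtension_mean_value (hS : S.Finite) (g : Site 2 → Site 2 → ℝ)
    {v : Site 2} (hv : v ∈ S) :
    4 * slitEdgeDirichletExtension S g v =
      ∑ k : Fin 4, (if v + cornerUnit k ∈ S then slitEdgeDirichletExtension S g (v + cornerUnit k)
        else g v (v + cornerUnit k)) :=
  (isSlitEdgeDirichletSolution_slitEdgeDirichletExtension hS g).2 v hv

/-- The Poisson equation `Δ u = -slitEdgeBoundarySum S g` on the finite set `S`. [folklore] -/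
theorem latticeLaplacian_slitEdgeDirichletExtension (hS : S.Finite) (g : Site 2 → Site 2 → ℝ)
    {v : Site 2} (hv : v ∈ S) :
    latticeLaplacian (slitEdgeDirichletExtension S g) v = -slitEdgeBoundarySum S g v :=
  (isSlitEdgeDirichletSolution_iff_latticeLaplacian.1
    (isSlitEdgeDirichletSolution_slitEdgeDirichletExtension hS g)).2 v hv

/-- **Locality in the data**: extensions of data agreeing on the boundary edges agree (for every
`S`). [folklore] -/
theorem slitEdgeDirichletExtension_congr {g₁ g₂ : Site 2 → Site 2 → ℝ}
    (h : ∀ v ∈ S, ∀ k : Fin 4, v + cornerUnit k ∉ S →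
      g₁ v (v + cornerUnit k) = g₂ v (v + cornerUnit k)) :
    slitEdgeDirichletExtension S g₁ = slitEdgeDirichletExtension S g₂ := by
  have hP : IsSlitEdgeDirichletSolution S g₁ = IsSlitEdgeDirichletSolution S g₂ :=
    funext fun u => propext (isSlitEdgeDirichletSolution_congr h u)
  unfold slitEdgeDirichletExtension
  rw [hP]

/-! ### Linearity in the data -/

/-- Additivity in the data. [folklore] -/
theorem slitEdgeDirichletExtension_add (hS : S.Finite) (g₁ g₂ : Site 2 → Site 2 → ℝ) :
    slitEdgeDirichletExtension S (g₁ + g₂) =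
      slitEdgeDirichletExtension S g₁ + slitEdgeDirichletExtension S g₂ :=
  (((isSlitEdgeDirichletSolution_slitEdgeDirichletExtension hS g₁).add
    (isSlitEdgeDirichletSolution_slitEdgeDirichletExtension hS g₂)).unique hS
      (isSlitEdgeDirichletSolution_slitEdgeDirichletExtension hS (g₁ + g₂))).symm

/-- Homogeneity in the data. [folklore] -/
theorem slitEdgeDirichletExtension_smul (hS : S.Finite) (c : ℝ) (g : Site 2 → Site 2 → ℝ) :
    slitEdgeDirichletExtension S (c • g) = c • slitEdgeDirichletExtension S g :=
  (((isSlitEdgeDirichletSolution_slitEdgeDirichletExtension hS g).smul c).unique hS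
    (isSlitEdgeDirichletSolution_slitEdgeDirichletExtension hS (c • g))).symm

/-- Zero data give the zero extension. [folklore] -/
theorem slitEdgeDirichletExtension_zero (hS : S.Finite) :
    slitEdgeDirichletExtension S (0 : Site 2 → Site 2 → ℝ) = 0 := by
  have h := slitEdgeDirichletExtension_smul hS 0 0
  rwa [zero_smul, zero_smul] at h

/-- The extension of `-g`. [folklore] -/
theorem slitEdgeDirichletExtension_neg (hS : S.Finite) (g : Site 2 → Site 2 → ℝ) :
    slitEdgeDirichletExtension S (-g) = -slitEdgeDirichletExtension S g := by
  rw [← neg_one_smul ℝ g, slitEdgeDirichletExtension_smul hS, neg_one_smul]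

/-- The extension of a difference. [folklore] -/
theorem slitEdgeDirichletExtension_sub (hS : S.Finite) (g₁ g₂ : Site 2 → Site 2 → ℝ) :
    slitEdgeDirichletExtension S (g₁ - g₂) =
      slitEdgeDirichletExtension S g₁ - slitEdgeDirichletExtension S g₂ := by
  rw [sub_eq_add_neg, slitEdgeDirichletExtension_add hS, slitEdgeDirichletExtension_neg hS,
    ← sub_eq_add_neg]

/-- The extension of a finite sum of data. [folklore] -/
theorem slitEdgeDirichletExtension_sum (hS : S.Finite) {ι : Type*} (s : Finset ι)
    (g : ι → Site 2 → Site 2 → ℝ) :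
    slitEdgeDirichletExtension S (∑ i ∈ s, g i) = ∑ i ∈ s, slitEdgeDirichletExtension S (g i) := by
  classical
  induction s using Finset.induction_on with
  | empty => simp [slitEdgeDirichletExtension_zero hS]
  | insert i s hi ih =>
    rw [Finset.sum_insert hi, Finset.sum_insert hi, slitEdgeDirichletExtension_add hS, ih]

/-! ### The maximum principle -/

/-- **Maximum principle (upper).** If `g ≤ M` on the boundary edges of the finite set `S`, then the
extension is `≤ M` on `S`: the function equal to `u` on `S` and to `M` off `S` is subharmonic on `S`
(`Δ = ∑_{exterior k} (M - g v (v + e_k)) ≥ 0`), so the vertex maximum principle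
`IsLatticeSubharmonicOn.le_of_forall_boundary_le` applies. [folklore] -/
theorem slitEdgeDirichletExtension_le_of_forall_le (hS : S.Finite) {g : Site 2 → Site 2 → ℝ}
    {M : ℝ} (hM : ∀ v ∈ S, ∀ k : Fin 4, v + cornerUnit k ∉ S → g v (v + cornerUnit k) ≤ M) :
    ∀ v ∈ S, slitEdgeDirichletExtension S g v ≤ M := by
  classical
  have hsol := isSlitEdgeDirichletSolution_slitEdgeDirichletExtension hS g
  let H : Site 2 → ℝ := fun x => if x ∈ S then slitEdgeDirichletExtension S g x else M
  have hsub : IsLatticeSubharmonicOn H S := fun v hv => by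
    rw [latticeLaplacian_eq]
    have h4 : (4 : ℝ) * H v = 4 * slitEdgeDirichletExtension S g v := by simp [H, hv]
    rw [h4, hsol.2 v hv, ← Finset.sum_sub_distrib]
    refine Finset.sum_nonneg fun k _ => ?_
    by_cases hk : v + cornerUnit k ∈ S
    · simp [H, hk]
    · simp only [H, hk, if_false, sub_nonneg]
      exact hM v hv k hk
  intro v hv
  have key := hsub.le_of_forall_boundary_le hS (M := M) (fun w hw => by simp [H, hw.1]) v hv
  simpa [H, hv] using key

/-- **Maximum principle (lower).** If `m ≤ g` on the boundary edges of the finite set `S`, then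
`m ≤` the extension on `S`. [folklore] -/
theorem le_slitEdgeDirichletExtension_of_forall_le (hS : S.Finite) {g : Site 2 → Site 2 → ℝ}
    {m : ℝ} (hm : ∀ v ∈ S, ∀ k : Fin 4, v + cornerUnit k ∉ S → m ≤ g v (v + cornerUnit k)) :
    ∀ v ∈ S, m ≤ slitEdgeDirichletExtension S g v := by
  intro v hv
  have h := slitEdgeDirichletExtension_le_of_forall_le hS (g := -g) (M := -m)
    (fun v hv k hk => by simpa using hm v hv k hk) v hv
  rw [slitEdgeDirichletExtension_neg hS, Pi.neg_apply] at h
  exact neg_le_neg_iff.1 h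

/-- **Maximum principle (two-sided)**: `|u| ≤ M` on `S` if `|g| ≤ M` on the boundary edges.
[folklore] -/
theorem abs_slitEdgeDirichletExtension_le (hS : S.Finite) {g : Site 2 → Site 2 → ℝ} {M : ℝ}
    (hM : ∀ v ∈ S, ∀ k : Fin 4, v + cornerUnit k ∉ S → |g v (v + cornerUnit k)| ≤ M) :
    ∀ v ∈ S, |slitEdgeDirichletExtension S g v| ≤ M := fun v hv =>
  abs_le.2 ⟨le_slitEdgeDirichletExtension_of_forall_le hS
      (fun v hv k hk => (abs_le.1 (hM v hv k hk)).1) v hv,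
    slitEdgeDirichletExtension_le_of_forall_le hS (fun v hv k hk => (abs_le.1 (hM v hv k hk)).2) v hv⟩

/-- Nonnegative data give a nonnegative extension (everywhere). [folklore] -/
theorem slitEdgeDirichletExtension_nonneg (hS : S.Finite) {g : Site 2 → Site 2 → ℝ}
    (hg : ∀ v ∈ S, ∀ k : Fin 4, v + cornerUnit k ∉ S → 0 ≤ g v (v + cornerUnit k)) (x : Site 2) :
    0 ≤ slitEdgeDirichletExtension S g x := by
  by_cases hx : x ∈ S
  · exact le_slitEdgeDirichletExtension_of_forall_le hS hg x hx
  · rw [slitEdgeDirichletExtension_eq_zero_of_not_mem g hx]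

/-- **Monotonicity in the data** (comparison principle). [folklore] -/
theorem slitEdgeDirichletExtension_mono (hS : S.Finite) {g₁ g₂ : Site 2 → Site 2 → ℝ}
    (h : ∀ v ∈ S, ∀ k : Fin 4, v + cornerUnit k ∉ S →
      g₁ v (v + cornerUnit k) ≤ g₂ v (v + cornerUnit k)) :
    slitEdgeDirichletExtension S g₁ ≤ slitEdgeDirichletExtension S g₂ := by
  intro x
  have key := slitEdgeDirichletExtension_nonneg hS (g := g₂ - g₁)
    (fun v hv k hk => by simpa using h v hv k hk) x
  rw [slitEdgeDirichletExtension_sub hS, Pi.sub_apply] at key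
  exact sub_nonneg.1 key

/-! ### Vertex data and constants -/

/-- **Compatibility with the vertex Dirichlet problem.** If the datum `g v w = h w` depends only on
the exterior endpoint, the edge-data extension agrees on `S` with the (unique) function harmonic on
`S` with boundary values `h` (`exists_isLatticeHarmonicOn_eq_off`, `isLatticeHarmonicOn_unique`).
[folklore] -/
theorem slitEdgeDirichletExtension_eq_of_isLatticeHarmonicOn (hS : S.Finite)
    {u h : Site 2 → ℝ} (hu : IsLatticeHarmonicOn u S)
    (hb : ∀ w ∈ latticeOuterBoundary S, u w = h w) {v : Site 2} (hv : v ∈ S) :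
    slitEdgeDirichletExtension S (fun _ w => h w) v = u v := by
  classical
  let u' : Site 2 → ℝ := fun x => if x ∈ S then u x else 0
  have hsol : IsSlitEdgeDirichletSolution S (fun _ w => h w) u' := by
    refine ⟨fun w hw => by simp [u', hw], fun v hv => ?_⟩
    have h4 : (4 : ℝ) * u' v = 4 * u v := by simp [u', hv]
    have hmv : 4 * u v = ∑ k : Fin 4, u (v + cornerUnit k) := by
      have h0 := hu v hv
      rw [latticeLaplacian_eq] at h0
      linarith
    rw [h4, hmv]
    refine Finset.sum_congr rfl fun k _ => ?_
    by_cases hk : v + cornerUnit k ∈ S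
    · simp [u', hk]
    · simp only [hk, if_false]
      exact hb _ ⟨hk, v, hv, k, rfl⟩
  rw [← congrFun (hsol.unique hS (isSlitEdgeDirichletSolution_slitEdgeDirichletExtension hS _)) v]
  simp [u', hv]

/-- Constant data `c` on the boundary edges extend to the constant `c` on `S`. [folklore] -/
theorem slitEdgeDirichletExtension_const (hS : S.Finite) (c : ℝ) {v : Site 2} (hv : v ∈ S) :
    slitEdgeDirichletExtension S (fun _ _ => c) v = c :=
  slitEdgeDirichletExtension_eq_of_isLatticeHarmonicOn hS (u := fun _ => c) (h := fun _ => c)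
    (fun v _ => latticeLaplacian_const c v) (fun _ _ => rfl) hv

end Literature.Probability.LatticeModels
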